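import Summits.Ventures.HodgeRepro2.T5RecordJointOutsideDiscriminant
import Summits.Ventures.HodgeRepro2.T5RationalPlace
import Summits.Ventures.HodgeRepro2.T5DiscriminantUnramified
import Summits.Ventures.HodgeRepro2.T5CyclotomicNineSextic
import Summits.Ventures.HodgeRepro2.T5CyclotomicSevenHeckeCommutative
import Summits.Ventures.HodgeRepro2.T5CyclotomicSevenSplitPrime

/-!
# Joint consistency on the THIRD sextic Galois CM field of the record, `ℚ(ζ₉)`

Tier-5 support N3 / §G-N4.2 (seat p3, gen 88). The brief's case is the SEXTIC Galois CM field; the record holds three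
of them — `ℚ(ζ₇)` (the field of record), the non-cyclotomic `F = ℚ(ζ₂₁)^{⟨σ₁₃⟩}` (file 363) and `ℚ(ζ₉)` (file 280's
`T5CyclotomicNineSextic`: cyclic of degree `6`, CM; `p ≠ 3` unramified with `f(P/p) = ord(p mod 9)`; a place of
`ℚ(ζ₉)⁺` above `p ≠ 3` stays prime iff `ord(p mod 9)` is even: `p ≡ 2, 5 (mod 9)` inert of degree `6`, `p ≡ 8 (mod 9)`
of degree `2`). This file is the `ℚ(ζ₉)` companion of file 363:

* `natCast_mem_of_liesOver_of_liesOver` — `p ∈ v` for the place `v` of `K⁺` under a prime `P ∣ p` of `K` (any field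
  `K`; file 363's lemma on `F` is the special case `K = F`);
* **`discr_nine_notMem`** — `disc ℚ(ζ₉) ∉ v` for every place `v` of `ℚ(ζ₉)⁺` containing a prime `p ∤ 9` (file 362 with
  the record's `ramificationIdx_eq_one_nine`);
* **`joint_nine_of_map_eq`** — for `p ∤ 9`, `p ∈ v`, `w` with `v 𝓞_K = w`: the lattice-model data for
  `diag(1, 1, −1)` at `v` over `vRat p` AND the unramified spectrum of the record's pair at `v` (Satake parameter
  `α · N(v)⁻²`) — file 356 at `vp = vRat p`;
* **`joint_nine_of_even_orderOf`** — the same at every place of `ℚ(ζ₉)⁺` above every prime `p ∤ 9` with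
  `ord(p mod 9)` even (the record's `exists_map_eq_iff_even_orderOf_nine`), i.e. at EVERY place that stays prime;
  the numerals `2` (`N(v) = 8`) and `17` (`N(v) = 17`) are file 366 (`T5RecordJointNineNumerals`).

With files 349 / 352 / 356 / 358 / 359 / 363: README §10.5 (ii)(d) is kernel on all three sextic Galois CM fields of the
record at every place that stays prime. The instances `NumberField ℚ(ζ₉)` / `IsCMField ℚ(ζ₉)` are the record's
theorems `numberField_nine` / `isCMField_nine`, bound by `haveI` at the head of each statement (file 280's style);
the `LiesOver` instances are bound by explicit terms and passed explicitly (annex §101(b)). §8(d): uses an L-value-free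
non-vanishing device: NO.
-/
open Matrix NumberField NumberField.IsCMField IsDedekindDomain IsDedekindDomain.HeightOneSpectrum Module
  MulAction
open scoped TensorProduct Pointwise
open Summit.Ventures.HodgeRepro2.T5UnitaryGroupForm Summit.Ventures.HodgeRepro2.T5UnitaryHeckeAdjoint
  Summit.Ventures.HodgeRepro2.T5HeckePermutationModule Summit.Ventures.HodgeRepro2.LevelPositivity
  Summit.Ventures.HodgeRepro2.T5LevelIdempotent Summit.Ventures.HodgeRepro2.T5StarOfInvolution
  Summit.Ventures.HodgeRepro2.T5FinitePlaceCM Summit.Ventures.HodgeRepro2.T5NonSplitPlaceUnitaryGroup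
  Summit.Ventures.HodgeRepro2.T5RecordHyperspecial Summit.Ventures.HodgeRepro2.T5GlobalLatticeAlmostAll
  Summit.Ventures.HodgeRepro2.T5HermitianThreeElements Summit.Ventures.HodgeRepro2.T5GaloisCartanThree
  Summit.Ventures.HodgeRepro2.T5InertDegreeGalois Summit.Ventures.HodgeRepro2.T5InertPlaceCompletion
  Summit.Ventures.HodgeRepro2.T5InertDegreeAdicCompletion Summit.Ventures.HodgeRepro2.T5InertSatakeTransform
  Summit.Ventures.HodgeRepro2.T5InertSatakeTransformCompletion Summit.Ventures.HodgeRepro2.T5InertUnipotentResidue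
  Summit.Ventures.HodgeRepro2.T5InertSphericalSubquotient Summit.Ventures.HodgeRepro2.T5RecordSatakeCell
  Summit.Ventures.HodgeRepro2.T5SplitPlaceUnitaryGroup Summit.Ventures.HodgeRepro2.T5FinitePlaceNormIndex
  Summit.Ventures.HodgeRepro2.T5HermitianLocalIsotropyN3 Summit.Ventures.HodgeRepro2.T5FinitePlaceSplitClassification
  Summit.Ventures.HodgeRepro2.T5InertDegreeCompletion Summit.Ventures.HodgeRepro2.T5InertPlaceCompletionCells
  Summit.Ventures.HodgeRepro2.T5RecordSatake Summit.Ventures.HodgeRepro2.T5CartanCellsDistinct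
  Summit.Ventures.HodgeRepro2.T5RecordSatakeInert Summit.Ventures.HodgeRepro2.T5InertGlobalPrime
  Summit.Ventures.HodgeRepro2.T5CMFieldSquareDatum Summit.Ventures.HodgeRepro2.T5RecordSatakeDegree
  Summit.Ventures.HodgeRepro2.T5RecordSatakeDegreeIntrinsic Summit.Ventures.HodgeRepro2.T5RecordSphericalSpectrum
  Summit.Ventures.HodgeRepro2.T5RecordSphericalSpectrumIntrinsic Summit.Ventures.HodgeRepro2.T5RecordSatakeToy
  Summit.Ventures.HodgeRepro2.T5RecordSphericalSpectrumDatumFree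
  Summit.Ventures.HodgeRepro2.T5AdditiveConductor Summit.Ventures.HodgeRepro2.T5UnitaryGroupIsometry
  Summit.Ventures.HodgeRepro2.T5ConductorDualLattice Summit.Ventures.HodgeRepro2.T5ConductorDualLatticeSplit
  Summit.Ventures.HodgeRepro2.T5SplitHermitianClass Summit.Ventures.HodgeRepro2.T5RecordLatticeModelOutsideDiscriminant
  Summit.Ventures.HodgeRepro2.T5RecordLatticeModelSeven Summit.Ventures.HodgeRepro2.T5RecordJointOutsideDiscriminant
  Summit.Ventures.HodgeRepro2.T5RationalPlace Summit.Ventures.HodgeRepro2.T5DiscriminantUnramified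
  Summit.Ventures.HodgeRepro2.T5CyclotomicSevenHeckeCommutative
  Summit.Ventures.HodgeRepro2.T5CyclotomicNineSextic Summit.Ventures.HodgeRepro2.T5CyclotomicSevenSplitPrime

namespace Summit.Ventures.HodgeRepro2.T5RecordJointNine

universe uV

section General

variable (K : Type*) [Field K] (p : ℕ)

/-- `p ∈ v` for the place `v` of `K⁺` under a prime `P` of `K` lying over `(p)` (the general form of file 363's
lemma on `F`; the record's `natCast_mem_under_of_liesOver`). -/
theorem natCast_mem_of_liesOver_of_liesOver (P : Ideal (𝓞 K)) [P.LiesOver (Ideal.span {(p : ℤ)})]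
    (v : HeightOneSpectrum (𝓞 (maximalRealSubfield K))) [hPv : P.LiesOver v.asIdeal] :
    (p : 𝓞 (maximalRealSubfield K)) ∈ v.asIdeal := by
  have h := natCast_mem_under_of_liesOver K p P
  rwa [← hPv.over] at h

end General

section Nine

variable (K : Type*) [Field K] [CharZero K] [IsCyclotomicExtension {9} ℚ K]
variable (p : ℕ) [hp : Fact p.Prime]
variable (k : Type*) [Field k] [CharZero k] [IsAlgClosed k]

/-- **`disc ℚ(ζ₉) ∉ v` for every place `v` of `ℚ(ζ₉)⁺` containing a prime `p ∤ 9`** (file 362 with the record's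
`ramificationIdx_eq_one_nine`: every prime of `ℚ(ζ₉)` above `p ∤ 9` has `e = 1`). -/
theorem discr_nine_notMem (hp9 : ¬ p ∣ 9) (v : HeightOneSpectrum (𝓞 (maximalRealSubfield K)))
    (hmem : (p : 𝓞 (maximalRealSubfield K)) ∈ v.asIdeal) :
    haveI := numberField_nine K
    ((discr K : ℤ) : 𝓞 (maximalRealSubfield K)) ∉ v.asIdeal :=
  haveI := numberField_nine K
  haveI := liesOver_int_of_mem p v hmem
  discr_notMem_of_forall_ramificationIdx_eq_one K p
    (fun w hw =>
      haveI := liesOver_int_of_mem p w hw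
      ramificationIdx_eq_one_nine K p hp9 w.asIdeal) v

/-- **JOINT CONSISTENCY ON `ℚ(ζ₉)` AT EVERY PLACE THAT STAYS PRIME, ABOVE `p ∤ 9`** (file 356 at `vp = vRat p`): for a
place `v` of `ℚ(ζ₉)⁺` containing `p` and `w` with `v 𝓞_K = w`, the lattice-model data for `diag(1, 1, −1)` AND the
unramified spectrum of the record's pair. -/
theorem joint_nine_of_map_eq (hp9 : ¬ p ∣ 9) (v : HeightOneSpectrum (𝓞 (maximalRealSubfield K)))
    (hmem : (p : 𝓞 (maximalRealSubfield K)) ∈ v.asIdeal) (w : HeightOneSpectrum (𝓞 K))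
    (hmap : Ideal.map (algebraMap (𝓞 (maximalRealSubfield K)) (𝓞 K)) v.asIdeal = w.asIdeal) :
    haveI := numberField_nine K
    haveI := isCMField_nine K
    letI : v.asIdeal.LiesOver (vRat p).asIdeal := liesOver_vRat_of_mem p v hmem
    letI := liesOver_of_map_eq K v w hmap
    ((∃ ψ : AddChar ((vRat p).adicCompletion ℚ) Circle, Continuous ψ ∧ (∃ y, ψ y ≠ 1) ∧
      conductorExp ψ (Valued.v : Valuation ((vRat p).adicCompletion ℚ) (WithZero (Multiplicative ℤ))) = 0 ∧
      conductorExp (ψ.compAddMonoidHom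
        (Algebra.trace ((vRat p).adicCompletion ℚ) (v.adicCompletion (maximalRealSubfield K))).toAddMonoidHom)
        (Valued.v : Valuation (v.adicCompletion (maximalRealSubfield K)) (WithZero (Multiplicative ℤ))) = 0) ∧
    ∀ (ψ : AddChar ((vRat p).adicCompletion ℚ) Circle), Continuous ψ → (∃ y, ψ y ≠ 1) →
      conductorExp ψ (Valued.v : Valuation ((vRat p).adicCompletion ℚ) (WithZero (Multiplicative ℤ))) = 0 →
      ∀ (w' : HeightOneSpectrum (𝓞 K)) [w'.asIdeal.LiesOver v.asIdeal],
        v.asIdeal.ramificationIdx' w'.asIdeal = 1 ∧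
        conductorExp (recordChar K (vRat p) v w' ψ)
          (Valued.v : Valuation (w'.adicCompletion K) (WithZero (Multiplicative ℤ))) = 0 ∧
        (∀ x : w'.adicCompletion K,
          (∀ y : w'.adicCompletion K, Valued.v y ≤ 1 → recordChar K (vRat p) v w' ψ (x * y) = 1) ↔ Valued.v x ≤ 1) ∧
        (∀ [StarRing (w'.adicCompletion K)],
          (∀ z : w'.adicCompletion K, IsLocalization.IsInteger (w'.adicCompletionIntegers K) z →
            IsLocalization.IsInteger (w'.adicCompletionIntegers K) (star z)) →
          ∀ x : Fin 3 → w'.adicCompletion K,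
            (∀ y ∈ stdLattice (w'.adicCompletionIntegers K),
              recordChar K (vRat p) v w' ψ
                (sesqForm (((algebraMap (𝓞 K) K).mapMatrix (Matrix.diagonal ![1, 1, -1])).map (algebraMap K (w'.adicCompletion K))) x y) = 1) ↔
              x ∈ stdLattice (w'.adicCompletionIntegers K)) ∧
        (letI := swapStarRing (w'.adicCompletion K)
          ∀ x : Fin 3 → w'.adicCompletion K × w'.adicCompletion K,
            (∀ y : Fin 3 → w'.adicCompletion K × w'.adicCompletion K,
              (∀ i, Valued.v (y i).1 ≤ 1 ∧ Valued.v (y i).2 ≤ 1) →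
              recordChar K (vRat p) v w' ψ
                  (sesqForm (pairMatrix (((algebraMap (𝓞 K) K).mapMatrix (Matrix.diagonal ![1, 1, -1])).map (algebraMap K (w'.adicCompletion K)))
                    (((algebraMap (𝓞 K) K).mapMatrix (Matrix.diagonal ![1, 1, -1])).map (algebraMap K (w'.adicCompletion K)))ᵀ) x y).1 *
                recordChar K (vRat p) v w' ψ
                  (sesqForm (pairMatrix (((algebraMap (𝓞 K) K).mapMatrix (Matrix.diagonal ![1, 1, -1])).map (algebraMap K (w'.adicCompletion K)))
                    (((algebraMap (𝓞 K) K).mapMatrix (Matrix.diagonal ![1, 1, -1])).map (algebraMap K (w'.adicCompletion K)))ᵀ) x y).2 = 1) ↔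
              ∀ i, Valued.v (x i).1 ≤ 1 ∧ Valued.v (x i).2 ≤ 1)) ∧
    (∃ (θ : maximalRealSubfield K) (y : K) (hθ : algebraMap (maximalRealSubfield K) K θ = y ^ 2)
      (hy : complexConj K y ≠ y) (r : ℕ) (l : Fin r → 𝓞 K)
      (_hl : Submodule.span (𝓞 (maximalRealSubfield K)) (Set.range l) = ⊤),
      letI := tensorStarRing K v
      letI := starRingOfQuadratic (finrank_eq_two K v w hθ hy (not_isSquare_of_staysPrime K v w hθ hy hmap))
        (localConj v w hθ.symm (span_pair_eq_top K hy) (not_isSquare_of_staysPrime K v w hθ hy hmap) (complexConj K))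
        (localConj_ne_one v w hθ.symm (span_pair_eq_top K hy) (not_isSquare_of_staysPrime K v w hθ hy hmap)
          (complexConj K) (complexConj_apply_eq_neg K hθ hy))
      haveI := isDiscreteValuationRing_integralClosure_adicCompletion v w
      haveI := finite_residueField_integralClosure_adicCompletion v w
      haveI : IsFractionRing (integralClosure (v.adicCompletionIntegers (maximalRealSubfield K)) (w.adicCompletion K))
        (w.adicCompletion K) :=
        integralClosure.isFractionRing_of_finite_extension (v.adicCompletion (maximalRealSubfield K))
          (w.adicCompletion K)
      ∃ (u₀ : (v.adicCompletionIntegers (maximalRealSubfield K))ˣ)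
        (Φ : ↥(formUnitaryGroup (J3 (algebraMap (v.adicCompletionIntegers (maximalRealSubfield K))
          (w.adicCompletion K) (u₀ : v.adicCompletionIntegers (maximalRealSubfield K))))) ≃*
          ↥(formUnitaryGroup (tensorGram K v (gramToy K))))
        (ϖ' : integralClosure (v.adicCompletionIntegers (maximalRealSubfield K)) (w.adicCompletion K))
        (hϖ' : Irreducible ϖ')
        (hs' : star (algebraMap (integralClosure (v.adicCompletionIntegers (maximalRealSubfield K))
          (w.adicCompletion K)) (w.adicCompletion K) ϖ') =
            algebraMap (integralClosure (v.adicCompletionIntegers (maximalRealSubfield K)) (w.adicCompletion K))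
              (w.adicCompletion K) ϖ'),
        (∀ g, g ∈ hyperspecialSubgroup
            (integralClosure (v.adicCompletionIntegers (maximalRealSubfield K)) (w.adicCompletion K))
            (J3 (algebraMap (v.adicCompletionIntegers (maximalRealSubfield K)) (w.adicCompletion K)
              (u₀ : v.adicCompletionIntegers (maximalRealSubfield K)))) ↔ Φ g ∈ recordHyperspecial K v l (gramToy K)) ∧
        ∀ {V : Type uV} [AddCommGroup V] [Module k V]
          (ρ : Representation k (↥(formUnitaryGroup (tensorGram K v (gramToy K)))) V) [ρ.IsIrreducible],
          KFinite ρ (recordHyperspecial K v l (gramToy K)) →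
          ∀ [FiniteDimensional k (invariants ρ (recordHyperspecial K v l (gramToy K)))],
          invariants ρ (recordHyperspecial K v l (gramToy K)) ≠ ⊥ →
          ∃ α : k, α ≠ 0 ∧ Nonempty (ρ.Equiv (comp Φ.symm
            (inertSphericalQuot
              (hstar_of_star_eq (localConj v w hθ.symm (span_pair_eq_top K hy)
                (not_isSquare_of_staysPrime K v w hθ hy hmap) (complexConj K))
                (fun x => by rw [star_p8_eq_star K v w hθ hy (not_isSquare_of_staysPrime K v w hθ hy hmap)]; rfl))
              (algebraMap (v.adicCompletionIntegers (maximalRealSubfield K)) (w.adicCompletion K)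
                (u₀ : v.adicCompletionIntegers (maximalRealSubfield K)))
              (star_algebraMap_of_star_eq (localConj v w hθ.symm (span_pair_eq_top K hy)
                (not_isSquare_of_staysPrime K v w hθ hy hmap) (complexConj K))
                (fun x => by rw [star_p8_eq_star K v w hθ hy (not_isSquare_of_staysPrime K v w hθ hy hmap)]; rfl)
                (u₀ : v.adicCompletionIntegers (maximalRealSubfield K)))
              (algebraMap_unit_ne_zero (F := v.adicCompletion (maximalRealSubfield K)) u₀)
              (isInteger_algebraMap (u₀ : v.adicCompletionIntegers (maximalRealSubfield K)))
              (isInteger_algebraMap_unit_inv u₀) hϖ' hs' k (α * ((Ideal.absNorm v.asIdeal : k) ^ 2)⁻¹))))) :=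
  haveI := numberField_nine K
  haveI := isCMField_nine K
  @joint_outside_discriminant_of_staysPrime K _ (numberField_nine K) (isCMField_nine K) (vRat p) v
    (liesOver_vRat_of_mem p v hmem) (discr_nine_notMem K p hp9 v hmem) w (liesOver_of_map_eq K v w hmap) hmap k _ _ _

/-- **JOINT CONSISTENCY ON `ℚ(ζ₉)` AT EVERY PLACE ABOVE EVERY PRIME THAT STAYS PRIME** — `p ∤ 9` with `ord(p mod 9)`
even, i.e. `p ≡ 2, 5, 8 (mod 9)` (the record's `exists_map_eq_iff_even_orderOf_nine`): the place `w` with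
`v 𝓞_K = w` is supplied. -/
theorem joint_nine_of_even_orderOf (hp9 : ¬ p ∣ 9) (P : Ideal (𝓞 K)) [P.IsPrime] [P.LiesOver (Ideal.span {(p : ℤ)})]
    (v : HeightOneSpectrum (𝓞 (maximalRealSubfield K))) [P.LiesOver v.asIdeal] (hEven : Even (orderOf (p : ZMod 9))) :
    haveI := numberField_nine K
    haveI := isCMField_nine K
    letI : v.asIdeal.LiesOver (vRat p).asIdeal := liesOver_vRat_of_mem p v (natCast_mem_of_liesOver_of_liesOver K p P v)
    ∃ (w : HeightOneSpectrum (𝓞 K))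
      (hmap : Ideal.map (algebraMap (𝓞 (maximalRealSubfield K)) (𝓞 K)) v.asIdeal = w.asIdeal),
      letI := liesOver_of_map_eq K v w hmap
      ((∃ ψ : AddChar ((vRat p).adicCompletion ℚ) Circle, Continuous ψ ∧ (∃ y, ψ y ≠ 1) ∧
        conductorExp ψ (Valued.v : Valuation ((vRat p).adicCompletion ℚ) (WithZero (Multiplicative ℤ))) = 0 ∧
        conductorExp (ψ.compAddMonoidHom
          (Algebra.trace ((vRat p).adicCompletion ℚ) (v.adicCompletion (maximalRealSubfield K))).toAddMonoidHom)
          (Valued.v : Valuation (v.adicCompletion (maximalRealSubfield K)) (WithZero (Multiplicative ℤ))) = 0) ∧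
      ∀ (ψ : AddChar ((vRat p).adicCompletion ℚ) Circle), Continuous ψ → (∃ y, ψ y ≠ 1) →
        conductorExp ψ (Valued.v : Valuation ((vRat p).adicCompletion ℚ) (WithZero (Multiplicative ℤ))) = 0 →
        ∀ (w' : HeightOneSpectrum (𝓞 K)) [w'.asIdeal.LiesOver v.asIdeal],
          v.asIdeal.ramificationIdx' w'.asIdeal = 1 ∧
          conductorExp (recordChar K (vRat p) v w' ψ)
            (Valued.v : Valuation (w'.adicCompletion K) (WithZero (Multiplicative ℤ))) = 0 ∧
          (∀ x : w'.adicCompletion K,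
            (∀ y : w'.adicCompletion K, Valued.v y ≤ 1 → recordChar K (vRat p) v w' ψ (x * y) = 1) ↔ Valued.v x ≤ 1) ∧
          (∀ [StarRing (w'.adicCompletion K)],
            (∀ z : w'.adicCompletion K, IsLocalization.IsInteger (w'.adicCompletionIntegers K) z →
              IsLocalization.IsInteger (w'.adicCompletionIntegers K) (star z)) →
            ∀ x : Fin 3 → w'.adicCompletion K,
              (∀ y ∈ stdLattice (w'.adicCompletionIntegers K),
                recordChar K (vRat p) v w' ψ
                  (sesqForm (((algebraMap (𝓞 K) K).mapMatrix (Matrix.diagonal ![1, 1, -1])).map (algebraMap K (w'.adicCompletion K))) x y) = 1) ↔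
                x ∈ stdLattice (w'.adicCompletionIntegers K)) ∧
          (letI := swapStarRing (w'.adicCompletion K)
            ∀ x : Fin 3 → w'.adicCompletion K × w'.adicCompletion K,
              (∀ y : Fin 3 → w'.adicCompletion K × w'.adicCompletion K,
                (∀ i, Valued.v (y i).1 ≤ 1 ∧ Valued.v (y i).2 ≤ 1) →
                recordChar K (vRat p) v w' ψ
                    (sesqForm (pairMatrix (((algebraMap (𝓞 K) K).mapMatrix (Matrix.diagonal ![1, 1, -1])).map (algebraMap K (w'.adicCompletion K)))
                      (((algebraMap (𝓞 K) K).mapMatrix (Matrix.diagonal ![1, 1, -1])).map (algebraMap K (w'.adicCompletion K)))ᵀ) x y).1 *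
                  recordChar K (vRat p) v w' ψ
                    (sesqForm (pairMatrix (((algebraMap (𝓞 K) K).mapMatrix (Matrix.diagonal ![1, 1, -1])).map (algebraMap K (w'.adicCompletion K)))
                      (((algebraMap (𝓞 K) K).mapMatrix (Matrix.diagonal ![1, 1, -1])).map (algebraMap K (w'.adicCompletion K)))ᵀ) x y).2 = 1) ↔
                ∀ i, Valued.v (x i).1 ≤ 1 ∧ Valued.v (x i).2 ≤ 1)) ∧
      (∃ (θ : maximalRealSubfield K) (y : K) (hθ : algebraMap (maximalRealSubfield K) K θ = y ^ 2)
        (hy : complexConj K y ≠ y) (r : ℕ) (l : Fin r → 𝓞 K)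
        (_hl : Submodule.span (𝓞 (maximalRealSubfield K)) (Set.range l) = ⊤),
        letI := tensorStarRing K v
        letI := starRingOfQuadratic (finrank_eq_two K v w hθ hy (not_isSquare_of_staysPrime K v w hθ hy hmap))
          (localConj v w hθ.symm (span_pair_eq_top K hy) (not_isSquare_of_staysPrime K v w hθ hy hmap) (complexConj K))
          (localConj_ne_one v w hθ.symm (span_pair_eq_top K hy) (not_isSquare_of_staysPrime K v w hθ hy hmap)
            (complexConj K) (complexConj_apply_eq_neg K hθ hy))
        haveI := isDiscreteValuationRing_integralClosure_adicCompletion v w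
        haveI := finite_residueField_integralClosure_adicCompletion v w
        haveI : IsFractionRing (integralClosure (v.adicCompletionIntegers (maximalRealSubfield K)) (w.adicCompletion K))
          (w.adicCompletion K) :=
          integralClosure.isFractionRing_of_finite_extension (v.adicCompletion (maximalRealSubfield K))
            (w.adicCompletion K)
        ∃ (u₀ : (v.adicCompletionIntegers (maximalRealSubfield K))ˣ)
          (Φ : ↥(formUnitaryGroup (J3 (algebraMap (v.adicCompletionIntegers (maximalRealSubfield K))
            (w.adicCompletion K) (u₀ : v.adicCompletionIntegers (maximalRealSubfield K))))) ≃*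
            ↥(formUnitaryGroup (tensorGram K v (gramToy K))))
          (ϖ' : integralClosure (v.adicCompletionIntegers (maximalRealSubfield K)) (w.adicCompletion K))
          (hϖ' : Irreducible ϖ')
          (hs' : star (algebraMap (integralClosure (v.adicCompletionIntegers (maximalRealSubfield K))
            (w.adicCompletion K)) (w.adicCompletion K) ϖ') =
              algebraMap (integralClosure (v.adicCompletionIntegers (maximalRealSubfield K)) (w.adicCompletion K))
                (w.adicCompletion K) ϖ'),
          (∀ g, g ∈ hyperspecialSubgroup
              (integralClosure (v.adicCompletionIntegers (maximalRealSubfield K)) (w.adicCompletion K))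
              (J3 (algebraMap (v.adicCompletionIntegers (maximalRealSubfield K)) (w.adicCompletion K)
                (u₀ : v.adicCompletionIntegers (maximalRealSubfield K)))) ↔ Φ g ∈ recordHyperspecial K v l (gramToy K)) ∧
          ∀ {V : Type uV} [AddCommGroup V] [Module k V]
            (ρ : Representation k (↥(formUnitaryGroup (tensorGram K v (gramToy K)))) V) [ρ.IsIrreducible],
            KFinite ρ (recordHyperspecial K v l (gramToy K)) →
            ∀ [FiniteDimensional k (invariants ρ (recordHyperspecial K v l (gramToy K)))],
            invariants ρ (recordHyperspecial K v l (gramToy K)) ≠ ⊥ →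
            ∃ α : k, α ≠ 0 ∧ Nonempty (ρ.Equiv (comp Φ.symm
              (inertSphericalQuot
                (hstar_of_star_eq (localConj v w hθ.symm (span_pair_eq_top K hy)
                  (not_isSquare_of_staysPrime K v w hθ hy hmap) (complexConj K))
                  (fun x => by rw [star_p8_eq_star K v w hθ hy (not_isSquare_of_staysPrime K v w hθ hy hmap)]; rfl))
                (algebraMap (v.adicCompletionIntegers (maximalRealSubfield K)) (w.adicCompletion K)
                  (u₀ : v.adicCompletionIntegers (maximalRealSubfield K)))
                (star_algebraMap_of_star_eq (localConj v w hθ.symm (span_pair_eq_top K hy)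
                  (not_isSquare_of_staysPrime K v w hθ hy hmap) (complexConj K))
                  (fun x => by rw [star_p8_eq_star K v w hθ hy (not_isSquare_of_staysPrime K v w hθ hy hmap)]; rfl)
                  (u₀ : v.adicCompletionIntegers (maximalRealSubfield K)))
                (algebraMap_unit_ne_zero (F := v.adicCompletion (maximalRealSubfield K)) u₀)
                (isInteger_algebraMap (u₀ : v.adicCompletionIntegers (maximalRealSubfield K)))
                (isInteger_algebraMap_unit_inv u₀) hϖ' hs' k (α * ((Ideal.absNorm v.asIdeal : k) ^ 2)⁻¹))))) :=
  haveI := numberField_nine K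
  haveI := isCMField_nine K
  ((exists_map_eq_iff_even_orderOf_nine K p hp9 P v).mpr hEven).elim fun w hmap =>
    ⟨w, hmap, @joint_outside_discriminant_of_staysPrime K _ (numberField_nine K) (isCMField_nine K) (vRat p) v
      (liesOver_vRat_of_mem p v (natCast_mem_of_liesOver_of_liesOver K p P v))
      (discr_nine_notMem K p hp9 v (natCast_mem_of_liesOver_of_liesOver K p P v)) w
      (liesOver_of_map_eq K v w hmap) hmap k _ _ _⟩

end Nine

end Summit.Ventures.HodgeRepro2.T5RecordJointNine
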